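import Summits.NavierStokesRegularity.TurbBounds.ShearSpecQForms
import Summits.NavierStokesRegularity.TurbBounds.PieceAssembly
import Mathlib.LinearAlgebra.Matrix.PosDef
import Mathlib.Algebra.BigOperators.Fin
import HarnessLib

/-!
# From the kernel's `rule_posSemidef` to `0 ≤ ωᵀ Q_m ω` in the `qform` language of the bridge files

Cell `turb-bounds` (pub-turb), shear lane, pub-turb-shear gen 6 (2026-08-22); v2 lane. The landed evaluators give
`((PieceAssembly.pieceSum n pieces1).map Rat.cast).PosSemidef` with `pieceSum n L = Σ_{(c, js, vs) ∈ L} c • matrixOfRows n n (densify n js vs)`.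
Here: `qform_matrixOfRows` (the `Fin`-indexed quadratic form of `matrixOfRows n n T` IS `qform T n` of the zero-extended vector),
`dot_mulVec_pieceSum` (linearity over the piece list) and **`pieces_form_nonneg`**: PosSemidef ⇒
`0 ≤ Σ_{(c,js,vs) ∈ L} c · qform (densify n js vs) n v̂` for every `v : Fin n → ℝ` — the hypothesis `hQ` of `ShearModeAssembly.mode_assembly`
once `SpecPieces<m>` rewrites each `densify` to the rule table. PURE ALGEBRA.
HONEST FRAMING: rigorous bounds for the stated PDE and boundary conditions; no claim about physical turbulence beyond the bound.
-/

set_option linter.style.longLine false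

namespace Summit.NavierStokesRegularity.TurbBounds.ShearSpecPieces

open Finset Matrix Literature.Computation.Certificates Summit.NavierStokesRegularity.TurbBounds.PieceAssembly

/-- Zero-extension of a `Fin n`-vector to `ℕ`. -/
def extFin {n : ℕ} (v : Fin n → ℝ) (i : ℕ) : ℝ := if h : i < n then v ⟨i, h⟩ else 0

/-- `x ⬝ᵥ ((matrixOfRows n n T).map cast *ᵥ x) = qform T n (extFin x)`. -/
theorem dot_mulVec_matrixOfRows {n : ℕ} (T : List (List ℚ)) (x : Fin n → ℝ) :
    x ⬝ᵥ (((matrixOfRows n n T).map (Rat.cast : ℚ → ℝ)) *ᵥ x) = qform T n (extFin x) := by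
  unfold qform bform dotProduct mulVec
  simp only [Matrix.map_apply, matrixOfRows_apply]
  rw [Finset.sum_fin_eq_sum_range]
  refine Finset.sum_congr rfl fun i hi => ?_
  have hi' : i < n := by simpa using hi
  rw [dif_pos hi']
  unfold dotProduct
  rw [Finset.mul_sum, Finset.sum_fin_eq_sum_range]
  refine Finset.sum_congr rfl fun j hj => ?_
  have hj' : j < n := by simpa using hj
  rw [dif_pos hj']
  unfold extFin get2
  rw [dif_pos hi', dif_pos hj']
  ring

/-- The form of a piece fold: `x ⬝ᵥ ((L.foldl (· + c•P) M).map cast *ᵥ x) = x ⬝ᵥ (M.map cast *ᵥ x) + Σ c·qform`. -/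
theorem dot_mulVec_foldl {n : ℕ} (x : Fin n → ℝ) :
    ∀ (L : List (ℚ × List (List ℕ) × List (List ℚ))) (M : Matrix (Fin n) (Fin n) ℚ),
      x ⬝ᵥ (((L.foldl (fun M p => M + p.1 • matrixOfRows n n (densify n p.2.1 p.2.2)) M).map (Rat.cast : ℚ → ℝ)) *ᵥ x)
        = x ⬝ᵥ ((M.map (Rat.cast : ℚ → ℝ)) *ᵥ x) + (L.map fun p => (p.1 : ℝ) * qform (densify n p.2.1 p.2.2) n (extFin x)).sum
  | [], M => by simp
  | p :: L, M => by
      rw [List.foldl_cons, dot_mulVec_foldl x L _]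
      have hadd : ((M + p.1 • matrixOfRows n n (densify n p.2.1 p.2.2)).map (Rat.cast : ℚ → ℝ))
          = M.map (Rat.cast : ℚ → ℝ) + (p.1 : ℝ) • (matrixOfRows n n (densify n p.2.1 p.2.2)).map (Rat.cast : ℚ → ℝ) := by
        ext i j; simp [Matrix.map_apply, Matrix.add_apply, Matrix.smul_apply]
      rw [hadd, Matrix.add_mulVec, dotProduct_add, Matrix.smul_mulVec, dotProduct_smul, dot_mulVec_matrixOfRows, smul_eq_mul]
      simp only [List.map_cons, List.sum_cons]
      ring

/-- `x ⬝ᵥ ((pieceSum n L).map cast *ᵥ x) = Σ_{(c,js,vs) ∈ L} c · qform (densify n js vs) n (extFin x)`. -/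
theorem dot_mulVec_pieceSum {n : ℕ} (L : List (ℚ × List (List ℕ) × List (List ℚ))) (x : Fin n → ℝ) :
    x ⬝ᵥ (((pieceSum n L).map (Rat.cast : ℚ → ℝ)) *ᵥ x) = (L.map fun p => (p.1 : ℝ) * qform (densify n p.2.1 p.2.2) n (extFin x)).sum := by
  unfold pieceSum
  rw [dot_mulVec_foldl x L 0]
  simp

/-- **PosSemidef ⇒ the piecewise form is nonnegative.** With `rule_posSemidef` of `Certs/<Row>/EvalBlock<m>` and the `SpecPieces<m>` identities
this is the hypothesis `hQ` of `ShearModeAssembly.mode_assembly` (for `v̂ = extFin x`; `qform` only reads indices `< n`). -/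
theorem pieces_form_nonneg {n : ℕ} {L : List (ℚ × List (List ℕ) × List (List ℚ))}
    (hPSD : ((pieceSum n L).map (Rat.cast : ℚ → ℝ)).PosSemidef) (x : Fin n → ℝ) :
    0 ≤ (L.map fun p => (p.1 : ℝ) * qform (densify n p.2.1 p.2.2) n (extFin x)).sum := by
  rw [← dot_mulVec_pieceSum]
  have h := hPSD.dotProduct_mulVec_nonneg x
  rwa [star_trivial] at h

end Summit.NavierStokesRegularity.TurbBounds.ShearSpecPieces
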